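import Mathlib.Algebra.Module.Torsion.Basic
import Mathlib.RingTheory.Length
import Mathlib.RingTheory.LocalRing.MaximalIdeal.Basic
import Literature.GroupTheory.FiniteAbelian.AlternatingPairing
import Literature.Algebra.Module.PIDInvariantFactors
import HarnessLib

/-!
# Symplectic parity of torsion layers: an alternating non-degenerate `R/𝔪`-valued form forces even
# length, and Howard's layer `H[ϖ^{s+1}]/(H[ϖ^s] + ϖH[ϖ^{s+2}])` versus the Ulm–Kaplansky socles

Topic `Algebra/Module`; namespace `Literature.Algebra.Module`. THEOREMS ONLY: no definition, no named fact, no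
instance, no `sorry`. This is the generic commutative algebra behind the ALGEBRAIC HALF of B. Howard, *The Heegner
point Kolyvagin system*, Compositio Math. **140** (2004), Thm. 1.4.2 (= arXiv:1202.6340 Thm. 2.4.2, p. 8
L88–96), used by the sequel `DVRModuleSymplecticLayersStructure.lean` (cell `pub/bsd-print-x9`, print leaf G87
`Literature.NumberTheory.GaloisCohomology.Howard2004.thm161_dvrKolyvaginBound`, registered stub `stub_h161` of the
shared μ-crux `MuInequalityCoherentPair`): there, for a module `ℋ` over a principal Artinian quotient
`R/𝔪^k` of a discrete valuation ring carrying the generalized Cassels–Tate pairings of Prop. 1.4.1, Howard writes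
«Abbreviate `ℋ = H¹_𝓕(K, T)`, and for `1 ≤ s < k` define `V_s = ℋ[𝔪^s]/𝔪ℋ[𝔪^{s+1}]` […]. We claim that […]
the `R/𝔪`-vector space `V_s` is even dimensional. The claim then follows easily from this and the structure
theorem for finitely-generated `R`-modules. […] We define a pairing `⟨ , ⟩ : V_s × V_s → R[𝔪]` by
`⟨a, b⟩ = (a, π^{s−1} b)_{s,1}`. The kernel on the right is `V_{s−1}`. If we can show that this pairing is
alternating, then `V_s/V_{s−1}` is even dimensional for every `1 ≤ s < k`, and the claim follows.»
The two inputs of that deduction which are pure module theory are proved here, for an arbitrary module: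

* `exists_length_eq_two_mul_of_alternating` — over a LOCAL ring `R`: a finitely generated `R`-module `W`
  killed by `𝔪` which carries an `R`-bilinear ALTERNATING form `W × W → R/𝔪` with trivial (right) radical has
  EVEN length (`∃ n, length_R W = 2n`). Proof: `W` is an `R/𝔪`-vector space, the form is an alternating
  non-degenerate bilinear form over the field `R/𝔪`, hence `dim_{R/𝔪} W` is even by the tree's
  `Literature.GroupTheory.FiniteAbelian.even_finrank_of_isAlt_of_nondegenerate` (hyperbolic planes), and
  `length_R W = length_{R/𝔪} W = dim_{R/𝔪} W` (Mathlib `Module.length_eq_of_surjective`, `Module.length_eq_finrank`).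
* `length_torsionByLayer_add_length_eq` — over ANY commutative ring `R`, for any `ϖ ∈ R`, any module `H` and any
  `s`: writing `T_k = H[ϖ^k]` and `P_k = (ϖ^k H)[ϖ]` (the `k`-th Ulm–Kaplansky socle, Kaplansky §11),
  `length_R (T_{s+1}/(T_s + ϖ T_{s+2})) + length_R P_{s+1} = length_R P_s`.
  Howard's quotient `V_{s+1}/V_s = T_{s+1}/(T_s + ϖT_{s+2})` is thus «the number of cyclic summands of order
  exactly `ϖ^{s+1}`» in length currency. Proof: `x ↦ ϖ^s x` maps `T_{s+1}` ONTO `P_s`; the preimage of the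
  classes lying in `ϖ^{s+1}H` is exactly `T_s + ϖT_{s+2}` (if `ϖ^s x = ϖ^{s+1} w` then `x − ϖw ∈ T_s` and
  `w ∈ T_{s+2}`); and `{y ∈ P_s | y ∈ ϖ^{s+1}H} ≅ P_{s+1}`; additivity of length.
* `length_torsionBy_eq_length_torsionBy_smul_top_zero` — bookkeeping: `length_R H[ϖ] = length_R P_0`
  (`ϖ^0 H = H`), to read the socle `H[ϖ]` in the same currency.

Lengths (`Module.length`, values in `ℕ∞`) are used instead of `R/𝔪`-dimensions so that no residue-field module
structure appears in the statements; `H[a]` is Mathlib's `Submodule.torsionBy R H a`, `ϖ^k H` is the pointwise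
`ϖ ^ k • ⊤` (as in `PIDInvariantFactors.lean`, `UlmInvariantsDirectSumOfCyclicModules.lean`).

References: [Howard2004HeegnerKolyvagin] Thm. 1.4.2 and its proof (arXiv:1202.6340, p. 8 L88–96);
[Kaplansky1954] I. Kaplansky, *Infinite Abelian Groups*, §11 (the Ulm invariants `f(n) = dim P_n/P_{n+1}`,
"the number of cyclic summands of order `p^{n+1}`"). Nothing number-theoretic is imported or proved here; Howard's
Prop. 1.4.1 (the generalized Cassels–Tate pairing) is NOT formalised here.
-/

noncomputable section

open Module Submodule
open scoped Pointwise

namespace Literature.Algebra.Module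

universe u v

/-! ### §1 An alternating non-degenerate `R/𝔪`-valued form forces even length -/

section LocalRing

variable {R : Type u} [CommRing R] [IsLocalRing R] {W : Type v} [AddCommGroup W] [Module R W]

/-- **Symplectic parity in length currency.** Let `R` be a local ring with maximal ideal `𝔪`, `W` a finitely
generated `R`-module killed by `𝔪`, and `B : W × W → R/𝔪` an `R`-bilinear ALTERNATING form (`B(x, x) = 0`) whose
right radical is trivial (`(∀ x, B(x, y) = 0) → y = 0`). Then `length_R W` is even: `W` is a finite-dimensional
`R/𝔪`-vector space with a non-degenerate alternating form, i.e. an orthogonal sum of hyperbolic planes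
(`Literature.GroupTheory.FiniteAbelian.even_finrank_of_isAlt_of_nondegenerate`), and `length_R W = dim_{R/𝔪} W`.
This is the step «if we can show that this pairing is alternating, then `V_s/V_{s−1}` is even dimensional» of
Howard's proof of Thm. 1.4.2, for an abstract `W` (classical symplectic linear algebra).
[cite: Howard2004HeegnerKolyvagin, Thm. 1.4.2, proof (arXiv:1202.6340 Thm. 2.4.2, p. 8 L93–96)] -/
theorem exists_length_eq_two_mul_of_alternating [Module.Finite R W]
    (hW : ∀ r ∈ IsLocalRing.maximalIdeal R, ∀ w : W, r • w = 0)
    (B : W →ₗ[R] W →ₗ[R] R ⧸ IsLocalRing.maximalIdeal R) (halt : ∀ x, B x x = 0)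
    (hnd : ∀ y, (∀ x, B x y = 0) → y = 0) :
    ∃ n : ℕ, Module.length R W = 2 * n := by
  classical
  have hW' : Module.IsTorsionBySet R W (IsLocalRing.maximalIdeal R) := fun w r => hW r.1 r.2 w
  letI : Module (R ⧸ IsLocalRing.maximalIdeal R) W := hW'.module
  haveI : IsScalarTower R (R ⧸ IsLocalRing.maximalIdeal R) W := hW'.isScalarTower
  letI : Field (R ⧸ IsLocalRing.maximalIdeal R) := Ideal.Quotient.field _
  haveI : Module.Finite (R ⧸ IsLocalRing.maximalIdeal R) W :=
    Module.Finite.of_restrictScalars_finite R _ _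
  have hsmul : ∀ (r : R) (w : W),
      (Ideal.Quotient.mk (IsLocalRing.maximalIdeal R) r) • w = r • w := fun r w => rfl
  have hskew : ∀ x y, B x y = -B y x := by
    intro x y
    have h := halt (x + y)
    simp only [map_add, LinearMap.add_apply, halt, zero_add, add_zero] at h
    exact eq_neg_of_add_eq_zero_right h
  let BF : LinearMap.BilinForm (R ⧸ IsLocalRing.maximalIdeal R) W :=
    LinearMap.mk₂ (R ⧸ IsLocalRing.maximalIdeal R) (fun x y => B x y)
      (fun x x' y => by rw [map_add, LinearMap.add_apply])
      (fun c x y => by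
        obtain ⟨r, rfl⟩ := Ideal.Quotient.mk_surjective c
        rw [hsmul, map_smul, LinearMap.smul_apply, Algebra.smul_def, Ideal.Quotient.algebraMap_eq,
          smul_eq_mul])
      (fun x y y' => by rw [map_add])
      (fun c x y => by
        obtain ⟨r, rfl⟩ := Ideal.Quotient.mk_surjective c
        rw [hsmul, map_smul, Algebra.smul_def, Ideal.Quotient.algebraMap_eq, smul_eq_mul])
  have hBF : ∀ x y, BF x y = B x y := fun x y => rfl
  have hBFalt : BF.IsAlt := fun x => halt x
  have hBFnd : BF.Nondegenerate := by
    refine ⟨fun x hx => hnd x fun y => ?_, fun y hy => hnd y fun x => hy x⟩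
    rw [hskew, ← hBF, hx y, neg_zero]
  obtain ⟨n, hn⟩ :=
    Literature.GroupTheory.FiniteAbelian.even_finrank_of_isAlt_of_nondegenerate hBFalt hBFnd
  refine ⟨n, ?_⟩
  rw [Module.length_eq_of_surjective (R := R ⧸ IsLocalRing.maximalIdeal R) (S := R) (M := W)
      Ideal.Quotient.mk_surjective, Module.length_eq_finrank, hn]
  push_cast
  ring

end LocalRing

/-! ### §2 Howard's layer `H[ϖ^{s+1}]/(H[ϖ^s] + ϖH[ϖ^{s+2}])` and the Ulm–Kaplansky socles `(ϖ^k H)[ϖ]` -/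

section Layer

variable {R : Type u} [CommRing R] {H : Type v} [AddCommGroup H] [Module R H]

/-- **Howard's layer has the length of an Ulm–Kaplansky factor.** For a commutative ring `R`, `ϖ ∈ R`, an
`R`-module `H` and `s ≥ 0`, with `T_k = H[ϖ^k]` (`Submodule.torsionBy`) and `P_k = (ϖ^k H)[ϖ]`:
`length_R (T_{s+1} ⧸ (T_s + ϖ T_{s+2})) + length_R P_{s+1} = length_R P_s`.
(The map `x ↦ ϖ^s x` sends `T_{s+1}` onto `P_s`; the preimage of `P_s ∩ ϖ^{s+1}H ≅ P_{s+1}` is `T_s + ϖT_{s+2}`;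
length is additive.) In Howard's proof of Thm. 1.4.2 the left quotient is `V_{s+1}/V_s` with
`V_s = ℋ[𝔪^s]/𝔪ℋ[𝔪^{s+1}]`, and for a direct sum of cyclic modules `length P_s − length P_{s+1}` is «the number of
cyclic summands of order `p^{s+1}`» (Kaplansky, *Infinite Abelian Groups*, §11).
[cite: Howard2004HeegnerKolyvagin, Thm. 1.4.2, proof (arXiv:1202.6340 Thm. 2.4.2, p. 8 L88–96)] -/
theorem length_torsionByLayer_add_length_eq (ϖ : R) (s : ℕ) :
    Module.length R (↥(torsionBy R H (ϖ ^ (s + 1))) ⧸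
        (torsionBy R H (ϖ ^ s) ⊔ ϖ • torsionBy R H (ϖ ^ (s + 2))).comap
          (torsionBy R H (ϖ ^ (s + 1))).subtype) +
      Module.length R (torsionBy R ↥(ϖ ^ (s + 1) • (⊤ : Submodule R H)) ϖ) =
    Module.length R (torsionBy R ↥(ϖ ^ s • (⊤ : Submodule R H)) ϖ) := by
  -- `Φ : H[ϖ^{s+1}] → (ϖ^s H)[ϖ]`, `x ↦ ϖ^s x`
  have hmemA : ∀ x : H, ϖ ^ s • x ∈ ϖ ^ s • (⊤ : Submodule R H) := fun x =>
    Submodule.smul_mem_pointwise_smul _ _ _ Submodule.mem_top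
  let Φ₀ : ↥(torsionBy R H (ϖ ^ (s + 1))) →ₗ[R] ↥(ϖ ^ s • (⊤ : Submodule R H)) :=
    LinearMap.codRestrict _ ((DistribSMul.toLinearMap R H (ϖ ^ s)).comp
      (torsionBy R H (ϖ ^ (s + 1))).subtype) fun x => hmemA x
  have hΦ₀ : ∀ x, ((Φ₀ x : ↥(ϖ ^ s • (⊤ : Submodule R H))) : H) = ϖ ^ s • (x : H) := fun x => rfl
  have hΦ₀P : ∀ x, Φ₀ x ∈ torsionBy R ↥(ϖ ^ s • (⊤ : Submodule R H)) ϖ := fun x => by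
    rw [mem_torsionBy_iff]
    apply Subtype.ext
    rw [Submodule.coe_smul, hΦ₀, smul_smul, ← pow_succ', Submodule.coe_zero]
    exact (mem_torsionBy_iff _ _).1 x.2
  let Φ : ↥(torsionBy R H (ϖ ^ (s + 1))) →ₗ[R] ↥(torsionBy R ↥(ϖ ^ s • (⊤ : Submodule R H)) ϖ) :=
    LinearMap.codRestrict _ Φ₀ hΦ₀P
  have hΦ : ∀ x, (((Φ x : ↥(torsionBy R ↥(ϖ ^ s • (⊤ : Submodule R H)) ϖ)) :
      ↥(ϖ ^ s • (⊤ : Submodule R H))) : H) = ϖ ^ s • (x : H) := fun x => rfl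
  -- `Φ` is onto
  have hΦsurj : Function.Surjective Φ := by
    intro y
    obtain ⟨z, -, hz⟩ := (Submodule.mem_smul_pointwise_iff_exists _ _ _).1
      (y : ↥(ϖ ^ s • (⊤ : Submodule R H))).2
    have hy : ϖ • ((y : ↥(ϖ ^ s • (⊤ : Submodule R H))) : H) = 0 := by
      have h := (mem_torsionBy_iff _ _).1 y.2
      rw [← Submodule.coe_smul, h, Submodule.coe_zero]
    have hz' : z ∈ torsionBy R H (ϖ ^ (s + 1)) := by
      rw [mem_torsionBy_iff, pow_succ', mul_smul, hz, hy]
    refine ⟨⟨z, hz'⟩, Subtype.ext (Subtype.ext ?_)⟩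
    rw [hΦ, hz]
  -- `Q` = the classes of `(ϖ^s H)[ϖ]` lying in `ϖ^{s+1} H`
  let Q : Submodule R ↥(torsionBy R ↥(ϖ ^ s • (⊤ : Submodule R H)) ϖ) :=
    (ϖ ^ (s + 1) • (⊤ : Submodule R H)).comap
      ((ϖ ^ s • (⊤ : Submodule R H)).subtype.comp (torsionBy R ↥(ϖ ^ s • (⊤ : Submodule R H)) ϖ).subtype)
  have hmemQ : ∀ y, y ∈ Q ↔ (((y : ↥(torsionBy R ↥(ϖ ^ s • (⊤ : Submodule R H)) ϖ)) :
      ↥(ϖ ^ s • (⊤ : Submodule R H))) : H) ∈ ϖ ^ (s + 1) • (⊤ : Submodule R H) := fun y => Iff.rfl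
  -- the kernel of `H[ϖ^{s+1}] → (ϖ^s H)[ϖ] / Q` is `H[ϖ^s] + ϖ H[ϖ^{s+2}]`
  have hker : LinearMap.ker (Q.mkQ.comp Φ) =
      (torsionBy R H (ϖ ^ s) ⊔ ϖ • torsionBy R H (ϖ ^ (s + 2))).comap
        (torsionBy R H (ϖ ^ (s + 1))).subtype := by
    rw [LinearMap.ker_comp, Submodule.ker_mkQ]
    ext x
    rw [Submodule.mem_comap, hmemQ, hΦ, Submodule.mem_comap, Submodule.subtype_apply]
    constructor
    · intro hx
      obtain ⟨w, -, hw⟩ := (Submodule.mem_smul_pointwise_iff_exists _ _ _).1 hx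
      have h1 : (x : H) - ϖ • w ∈ torsionBy R H (ϖ ^ s) := by
        rw [mem_torsionBy_iff, smul_sub, smul_smul, ← pow_succ, hw, sub_self]
      have h2 : w ∈ torsionBy R H (ϖ ^ (s + 2)) := by
        rw [mem_torsionBy_iff, pow_succ', mul_smul, hw, smul_smul, ← pow_succ']
        exact (mem_torsionBy_iff _ _).1 x.2
      have h3 : ϖ • w ∈ ϖ • torsionBy R H (ϖ ^ (s + 2)) := Submodule.smul_mem_pointwise_smul _ _ _ h2
      have h4 := Submodule.add_mem_sup h1 h3
      rwa [sub_add_cancel] at h4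
    · intro hx
      obtain ⟨a, ha, b, hb, hab⟩ := Submodule.mem_sup.1 hx
      obtain ⟨w, hw, rfl⟩ := (Submodule.mem_smul_pointwise_iff_exists _ _ _).1 hb
      rw [← hab, smul_add, (mem_torsionBy_iff _ _).1 ha, zero_add, smul_smul, ← pow_succ]
      exact Submodule.smul_mem_pointwise_smul _ _ _ Submodule.mem_top
  -- hence the layer is `≅ (ϖ^s H)[ϖ] / Q`
  have hsurj : Function.Surjective (Q.mkQ.comp Φ) := (Submodule.mkQ_surjective Q).comp hΦsurj
  have e₁ : (↥(torsionBy R H (ϖ ^ (s + 1))) ⧸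
      (torsionBy R H (ϖ ^ s) ⊔ ϖ • torsionBy R H (ϖ ^ (s + 2))).comap
        (torsionBy R H (ϖ ^ (s + 1))).subtype) ≃ₗ[R]
      (↥(torsionBy R ↥(ϖ ^ s • (⊤ : Submodule R H)) ϖ) ⧸ Q) :=
    (Submodule.quotEquivOfEq _ _ hker.symm).trans (LinearMap.quotKerEquivOfSurjective _ hsurj)
  -- and `Q ≅ (ϖ^{s+1} H)[ϖ]`
  let ψ : ↥Q →ₗ[R] ↥(torsionBy R ↥(ϖ ^ (s + 1) • (⊤ : Submodule R H)) ϖ) :=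
    { toFun := fun y => ⟨⟨_, (hmemQ y.1).1 y.2⟩, by
        rw [mem_torsionBy_iff]
        apply Subtype.ext
        have h := congrArg Subtype.val ((mem_torsionBy_iff _ _).1 y.1.2)
        rw [Submodule.coe_smul, Submodule.coe_zero] at h
        rw [Submodule.coe_smul, Submodule.coe_zero]
        exact h⟩
      map_add' := fun _ _ => rfl
      map_smul' := fun _ _ => rfl }
  have hψ : Function.Bijective ψ := by
    constructor
    · intro y y' h
      have h' := congrArg (fun z : ↥(torsionBy R ↥(ϖ ^ (s + 1) • (⊤ : Submodule R H)) ϖ) =>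
        ((z : ↥(ϖ ^ (s + 1) • (⊤ : Submodule R H))) : H)) h
      exact Subtype.ext (Subtype.ext (Subtype.ext h'))
    · intro z
      have hz1 : ((z : ↥(ϖ ^ (s + 1) • (⊤ : Submodule R H))) : H) ∈ ϖ ^ s • (⊤ : Submodule R H) := by
        obtain ⟨w, -, hw⟩ := (Submodule.mem_smul_pointwise_iff_exists _ _ _).1
          (z : ↥(ϖ ^ (s + 1) • (⊤ : Submodule R H))).2
        rw [← hw, pow_succ, mul_smul]
        exact Submodule.smul_mem_pointwise_smul _ _ _ Submodule.mem_top
      have hz2 : (⟨_, hz1⟩ : ↥(ϖ ^ s • (⊤ : Submodule R H))) ∈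
          torsionBy R ↥(ϖ ^ s • (⊤ : Submodule R H)) ϖ := by
        rw [mem_torsionBy_iff]
        apply Subtype.ext
        have h := congrArg Subtype.val ((mem_torsionBy_iff _ _).1 z.2)
        rw [Submodule.coe_smul, Submodule.coe_zero] at h
        rw [Submodule.coe_smul, Submodule.coe_zero]
        exact h
      exact ⟨⟨⟨_, hz2⟩, (hmemQ _).2 (z : ↥(ϖ ^ (s + 1) • (⊤ : Submodule R H))).2⟩, rfl⟩
  have e₂ : ↥Q ≃ₗ[R] ↥(torsionBy R ↥(ϖ ^ (s + 1) • (⊤ : Submodule R H)) ϖ) :=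
    LinearEquiv.ofBijective ψ hψ
  have h₁ := e₁.length_eq
  have h₂ : Module.length R ↥Q = Module.length R ↥(torsionBy R ↥(ϖ ^ (s + 1) • (⊤ : Submodule R H)) ϖ) :=
    e₂.length_eq
  rw [h₁, ← h₂, add_comm]
  exact (Module.length_eq_add_of_exact (N := ↥Q)
    (M := ↥(torsionBy R ↥(ϖ ^ s • (⊤ : Submodule R H)) ϖ))
    (P := ↥(torsionBy R ↥(ϖ ^ s • (⊤ : Submodule R H)) ϖ) ⧸ Q) Q.subtype Q.mkQ
    (Submodule.subtype_injective Q) (Submodule.mkQ_surjective Q) (LinearMap.exact_subtype_mkQ Q)).symm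

/-- Bookkeeping: the socle `H[ϖ]` is the `0`-th Ulm–Kaplansky socle `(ϖ^0 H)[ϖ]`, in length currency
(`ϖ^0 H = H`; the comparison isomorphism is `PIDInvariantFactors`' transport of `H[ϖ]` along `H ≅ ϖ^0 H`);
Kaplansky's `P_0 = M[p]`. [cite: Kaplansky1954, §11 (PDF p. 29: `P_n = p^n M ∩ M[p]`, `n = 0`)] -/
theorem length_torsionBy_eq_length_torsionBy_smul_top_zero (ϖ : R) :
    Module.length R (torsionBy R H ϖ) =
      Module.length R (torsionBy R ↥(ϖ ^ 0 • (⊤ : Submodule R H)) ϖ) := by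
  have e : H ≃ₗ[R] ↥(ϖ ^ 0 • (⊤ : Submodule R H)) :=
    (LinearEquiv.ofTop (ϖ ^ 0 • (⊤ : Submodule R H)) (by rw [pow_zero, one_smul])).symm
  obtain ⟨f⟩ := nonempty_torsionBy_linearEquiv_of_linearEquiv e ϖ
  exact (f.restrictScalars R).length_eq

end Layer

end Literature.Algebra.Module

end
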